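import Mathlib
import Literature.AlgebraicGeometry.Resolution.NormalizationOfVarietiesProofs
import Summits.ResolutionOfSingularities.ResolutionOfSingularities.Theorems.WildQuotientsWildQuotientResolutionRelAlgClosureFinite
import HarnessLib

/-!
# The integral closure of a finitely generated algebra in a finitely generated domain is finite
# (crux `WildQuotients.WildQuotientResolution`, stub `stub_phaseZeroHighDim`: discharge of (H2))

Crux stmt-ResolutionOfSingularities-15640 (`WildQuotientResolution`), registered stub `stub_phaseZeroHighDim`.
Algebraic core of the discharge of hypothesis (H2) (finiteness of relative normalisation over a field) of
✓`PhaseZeroReduction.phaseZero_conclusion_of_equivariantRegularModels`: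

**Theorem** (`module_finite_integralClosure_of_finiteType`). Let `k` be a field, `A` a finitely generated
`k`-algebra and `B` a finitely generated `k`-algebra which is a DOMAIN and an `A`-algebra compatibly with `k`.
Then the integral closure of `A` in `B` is a finite `A`-module.

Proof: with `L = Frac B`, `A₀ = im(A → L)` (a finitely generated `k`-domain), `K₀ = Frac A₀ ⊆ L` and
`K₁` the relative algebraic closure of `K₀` in `L` — a FINITE extension of `K₀` because `L/K₀` is finitely
generated (✓`RelAlgClosureFinite.finiteDimensional_algebraicClosure_of_adjoin_eq_top`) — the integral closure
of `A` in `B` embeds `A`-linearly into the integral closure of `A₀` in `K₁`, which is finite over `A₀` by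
E. Noether's theorem (✓`Resolution.NoetherFiniteIntegralClosure_holds`, Liu 2002 Prop. 4.1.27); `A` is
Noetherian and `A → A₀` is surjective. Also the version `module_finite_integralClosure_of_injective` for an
`A`-algebra `B` that merely EMBEDS into such a domain (used for rings of sections of non-affine opens).

[OURS · crux stmt-ResolutionOfSingularities-15640 · helper toward `stub_phaseZeroHighDim` (discharge of
hypothesis (H2) of the conditional reduction); counted 0; AI-level work, weaker than expert review.]
-/

-- single-problem summit: the doubled namespace component `ResolutionOfSingularities` is forced
set_option linter.dupNamespace false

noncomputable section

namespace Summit.ResolutionOfSingularities.ResolutionOfSingularities.Theorems.WildQuotientResolution.IntegralClosureFiniteType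

universe u v w

open scoped IntermediateField.algebraAdjoinAdjoin

open Literature.AlgebraicGeometry.Resolution (NoetherFiniteIntegralClosure_holds)

/-- The fraction field of a finitely generated `k`-domain `B` is a finitely generated field extension of
`k`: it is generated by the images of `k`-algebra generators of `B`. [folklore] -/
theorem exists_finset_adjoin_eq_top_fractionRing (k B : Type*) [Field k] [CommRing B] [IsDomain B]
    [Algebra k B] [Algebra.FiniteType k B] :
    ∃ s : Finset (FractionRing B), IntermediateField.adjoin k (s : Set (FractionRing B)) = ⊤ := by
  classical
  obtain ⟨sB, hsB⟩ := Algebra.FiniteType.out (R := k) (A := B)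
  refine ⟨sB.image (algebraMap B (FractionRing B)), ?_⟩
  set M := IntermediateField.adjoin k ((sB.image (algebraMap B (FractionRing B)) : Finset _) :
    Set (FractionRing B))
  have h1 : (⊤ : Subalgebra k B).map (IsScalarTower.toAlgHom k B (FractionRing B)) ≤
      M.toSubalgebra := by
    rw [← hsB, ← Algebra.adjoin_image]
    refine Algebra.adjoin_le ?_
    intro x hx
    refine IntermediateField.subset_adjoin _ _ ?_
    simpa [Finset.coe_image] using hx
  have hB : ∀ b : B, algebraMap B (FractionRing B) b ∈ M := fun b =>
    h1 (Subalgebra.mem_map.mpr ⟨b, Algebra.mem_top, rfl⟩)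
  refine eq_top_iff.mpr fun x _ => ?_
  obtain ⟨a, b, -, rfl⟩ := IsFractionRing.div_surjective (A := B) x
  exact div_mem (hB a) (hB b)

set_option maxHeartbeats 400000 in
/-- **The integral closure of a finitely generated `k`-algebra `A` in a finitely generated `k`-domain `B`
(an `A`-algebra compatibly with `k`) is a finite `A`-module** — E. Noether's finiteness theorem combined
with the finiteness of the relative algebraic closure in the finitely generated extension `Frac B ⊇ Frac A₀`.
[cite: Liu2002, Prop. 4.1.27] -/
theorem module_finite_integralClosure_of_finiteType (k B : Type u) (A : Type v) [Field k]
    [CommRing A] [Algebra k A] [Algebra.FiniteType k A] [CommRing B] [IsDomain B] [Algebra k B]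
    [Algebra.FiniteType k B] [Algebra A B] [IsScalarTower k A B] :
    Module.Finite A (integralClosure A B) := by
  classical
  -- `L = Frac B`, `S = im(A → L)`, `A₀ = k[S]`, `K₀ = k(S)`, `K₁` = algebraic closure of `K₀` in `L`
  let L := FractionRing B
  haveI : IsScalarTower k A L := IsScalarTower.of_algebraMap_eq fun x => by
    rw [IsScalarTower.algebraMap_apply A B L, IsScalarTower.algebraMap_apply k B L,
      IsScalarTower.algebraMap_apply k A B]
  let φ : A →ₐ[k] L := IsScalarTower.toAlgHom k A L
  let S : Set L := Set.range φ
  let A₀ : Subalgebra k L := Algebra.adjoin k S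
  let K₀ : IntermediateField k L := IntermediateField.adjoin k S
  have hA₀le : A₀ ≤ φ.range := Algebra.adjoin_le (Set.range_subset_iff.2 fun a => ⟨a, rfl⟩)
  let ψ : A →ₐ[k] A₀ := φ.codRestrict A₀ fun a => Algebra.subset_adjoin ⟨a, rfl⟩
  have hψ : Function.Surjective ψ := by
    rintro ⟨y, hy⟩
    obtain ⟨a, ha⟩ := hA₀le hy
    exact ⟨a, Subtype.ext ha⟩
  haveI : Algebra.FiniteType k A₀ := Algebra.FiniteType.of_surjective ψ hψ
  letI : Algebra A A₀ := ψ.toRingHom.toAlgebra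
  haveI : IsScalarTower A A₀ L := IsScalarTower.of_algebraMap_eq fun a => rfl
  -- `L / K₀` is finitely generated, so `K₁ / K₀` is finite
  obtain ⟨sL, hsL⟩ := exists_finset_adjoin_eq_top_fractionRing k B
  let K₁ : IntermediateField K₀ L := algebraicClosure K₀ L
  haveI : IsScalarTower A₀ K₁ L := IsScalarTower.of_algebraMap_eq fun _ => rfl
  haveI : FiniteDimensional K₀ K₁ := by
    refine RelAlgClosureFinite.finiteDimensional_algebraicClosure_of_adjoin_eq_top (sL : Set L)
      sL.finite_toSet ?_
    rw [← IntermediateField.restrictScalars_eq_top_iff (K := k),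
      IntermediateField.adjoin_adjoin_left, eq_top_iff, ← hsL]
    exact IntermediateField.adjoin.mono _ _ _ Set.subset_union_right
  -- E. Noether: the integral closure `N` of `A₀` in `K₁` is finite over `A₀`
  have hN : Module.Finite A₀ (integralClosure A₀ K₁) := NoetherFiniteIntegralClosure_holds k A₀ K₀ K₁
  -- its image `N'` in `L`, an `A`-submodule of `L`, is finitely generated over `A` (`A → A₀` onto)
  let N' : Submodule A L :=
    (((integralClosure A₀ K₁).map (IsScalarTower.toAlgHom A₀ K₁ L)).toSubmodule).restrictScalars A
  have hN' : N'.FG := by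
    refine Submodule.FG.restrictScalars_of_surjective ?_ hψ
    rw [Subalgebra.map_toSubmodule]
    exact (Module.Finite.iff_fg.mp hN).map _
  haveI : IsNoetherianRing A := Algebra.FiniteType.isNoetherianRing k A
  haveI : IsNoetherian A N' := isNoetherian_of_fg_of_noetherian _ hN'
  -- the integral closure of `A` in `B` embeds `A`-linearly into `N'`
  let i : B →ₐ[A] L := IsScalarTower.toAlgHom A B L
  have hi : Function.Injective i := IsFractionRing.injective B L
  let θ₀ : integralClosure A B →ₗ[A] L := (i.comp (integralClosure A B).val).toLinearMap
  have hθ₀ : ∀ c : integralClosure A B, θ₀ c ∈ N' := by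
    intro c
    have hc : IsIntegral A (i c) := IsIntegral.map i (show IsIntegral A (c : B) from c.2)
    have hc₀ : IsIntegral A₀ (i c) := hc.tower_top
    have hcK : IsIntegral K₀ (i c) := hc₀.tower_top
    have hmem : i c ∈ K₁ := mem_algebraicClosure_iff'.mpr hcK
    have hy : IsIntegral A₀ (⟨i c, hmem⟩ : K₁) :=
      (isIntegral_algHom_iff (IsScalarTower.toAlgHom A₀ K₁ L) Subtype.val_injective).mp hc₀
    change i c ∈ (integralClosure A₀ K₁).map (IsScalarTower.toAlgHom A₀ K₁ L)
    exact Subalgebra.mem_map.mpr ⟨⟨i c, hmem⟩, hy, rfl⟩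
  let θ : integralClosure A B →ₗ[A] N' := θ₀.codRestrict N' hθ₀
  have hθ : Function.Injective θ := by
    intro x y hxy
    have h' : i (x : B) = i (y : B) := congrArg Subtype.val hxy
    exact Subtype.ext (hi h')
  exact Module.Finite.of_injective θ hθ

/-- **The same for an `A`-algebra `B` which EMBEDS into a finitely generated `k`-domain `B₁`** (compatibly
with `k`): the integral closure of the finitely generated `k`-algebra `A` in `B` is a finite `A`-module —
it embeds `A`-linearly into the integral closure of `A` in `B₁`, and `A` is Noetherian. (Used for the
ring of sections of a non-affine open of a variety, which embeds into that of an affine open.)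
[cite: Liu2002, Prop. 4.1.27] -/
theorem module_finite_integralClosure_of_injective (k B₁ : Type u) (A : Type v) (B : Type w) [Field k]
    [CommRing A] [Algebra k A] [Algebra.FiniteType k A] [CommRing B₁] [IsDomain B₁] [Algebra k B₁]
    [Algebra.FiniteType k B₁] [CommRing B] [Algebra A B] (ι : B →+* B₁) (hι : Function.Injective ι)
    (hcomp : (ι.comp (algebraMap A B)).comp (algebraMap k A) = algebraMap k B₁) :
    Module.Finite A (integralClosure A B) := by
  letI : Algebra A B₁ := (ι.comp (algebraMap A B)).toAlgebra
  haveI : IsScalarTower k A B₁ := IsScalarTower.of_algebraMap_eq' hcomp.symm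
  haveI : IsNoetherianRing A := Algebra.FiniteType.isNoetherianRing k A
  haveI : Module.Finite A (integralClosure A B₁) := module_finite_integralClosure_of_finiteType k B₁ A
  haveI : IsNoetherian A (integralClosure A B₁) := isNoetherian_of_isNoetherianRing_of_finite A _
  let ι' : B →ₐ[A] B₁ := { ι with commutes' := fun _ => rfl }
  let θ : integralClosure A B →ₐ[A] integralClosure A B₁ :=
    (ι'.comp (integralClosure A B).val).codRestrict (integralClosure A B₁) fun c =>
      show IsIntegral A _ from IsIntegral.map ι' (show IsIntegral A (c : B) from c.2)
  have hθ : Function.Injective θ.toLinearMap := by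
    intro x y hxy
    have h' : ι (x : B) = ι (y : B) := congrArg Subtype.val hxy
    exact Subtype.ext (hι h')
  exact Module.Finite.of_injective θ.toLinearMap hθ

end Summit.ResolutionOfSingularities.ResolutionOfSingularities.Theorems.WildQuotientResolution.IntegralClosureFiniteType

end
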